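import Mathlib
import HarnessLib
import Summits.HubbardSuperconductivity.HubbardSuperconductivity.Theorems.KLProgrammeKLRegimeWickCrossContractionValue
import Summits.HubbardSuperconductivity.HubbardSuperconductivity.Theorems.KLProgrammeKLRegimeWickCrossContractionFat
import Summits.HubbardSuperconductivity.HubbardSuperconductivity.Theorems.KLProgrammeKLRegimeAlphaRegime

/-!
# Route `KLProgramme` — ENGINE child stmt-HubbardSuperconductivity-20236 `KLRegimeEngineV16`, `stub_engine_step_values` (E2-v10: the E.5 / `CR` classes
# at the PAIR LABELS): the VALUE form (every output leg fixed) of the `k + 1`-line two-vertex term on fat sector fields, engine slice `g_{n+j}`,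
# with ALL LINE CONSTANTS DISCHARGED (`α` p523001, `δ = κ²` p515376) — p5's `norm_kernel_crossContract_value_pullback_le` by name

Cell gate-hubbard-kl, seat hubbard-kl-k3c2-p3 (g4, row «sector-counting import (DR2000 L11/L12) for the leg-dress bar»).  Sequel of …WickCrossContractionFat /
…FatAlpha (the NORM form, one output leg pinned).  The (E2-v10) budget lines are VALUES at fixed pair labels, so the prover needs the value form:

* `norm_kernel_crossLaplacian_pow_bgmFat_value_le` — fat family of index `m+1`, one symbol on all `k+1` lines, `ρ₀ = 9`: `‖kernel (…) d (Z,s)‖ ≤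
  ((k+1+m₀)!(k+1+m₁)!/d!)·(α·(36δ)^k·Na·Nb)` (any `α ≥ 0`, `δ ≥ 0`);
* **`norm_kernel_crossLaplacian_pow_klSliceCov_bgmFat_klEng_value (j)`** — `∃ C > 0, ∃ D > 0`: under EXACTLY the gen-6 stub binders, `1 ≤ n`,
  `n + j ≤ nScales β + 1`, every `k d m₀ m₁ a b s Z` and vertex sizes `Na`, `Nb` (here: `a` with its `k+1` contracted legs SUMMED and its free legs FIXED;
  `b` with its contracted positions summed, contracted sectors and free legs fixed — p5's value-form shapes):
  `‖kernel ((Δ_×(S(Ft_n)ᵀ g_{n+j} S(Ft_n)))^{k+1} (a⁰ b¹)) d (Z,s)‖ ≤ ((k+1+m₀)!(k+1+m₁)!/d!)·((C·(M/β)/Λ_{n+j})·(36·(D·(Λ_n/Λ_{n+j})·e₀·8^{-n}))^k·Na·Nb)`.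

Pure composition; no definitions, no named facts. [cite: BenfattoGiulianiMastropietro2006, §2.8 (2.80)–(2.83)]
-/

noncomputable section

namespace Summit.HubbardSuperconductivity.HubbardSuperconductivity.Theorems.KLRegimeWick

set_option linter.dupNamespace false -- summit = problem name (single-conjunct summit), D-0017

open Literature.MathematicalPhysics.QuantumLattice Literature.Probability.LatticeModels GrassmannAlgebra Finset Matrix
open Summit.HubbardSuperconductivity.HubbardSuperconductivity.Theorems.KLProgrammeLegKernels
open Summit.HubbardSuperconductivity.HubbardSuperconductivity.Theorems.KLRegimeSplit
open Summit.HubbardSuperconductivity.HubbardSuperconductivity.Theorems.TorusFourierL2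

section Fat

variable {L M : ℕ} [NeZero L] (e₀ β μ : ℝ) (K : TrigPolyC4v) (m : ℕ)

/-- **VALUE form, one symbol on all lines, fat family of index `m+1`** (`ρ₀ = 9`): `‖kernel (…) d (Z,s)‖ ≤ ((k+1+m₀)!(k+1+m₁)!/d!)·(α·(36δ)^k·Na·Nb)`.
[cite: BenfattoGiulianiMastropietro2006, §2.7 (2.71a)] -/
theorem norm_kernel_crossLaplacian_pow_bgmFat_value_le {k d m₀ m₁ : ℕ} (sym : FreqMomentum L M × Fin 2 → ℂ)
    (a b : GrassmannAlgebra ℂ (SpaceTimeIdx L M × SectorLeg (sectorCount (m + 1)))) (s : Fin d → Fin 2)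
    (hm₀ : (univ.filter fun i => s i = 0).card = m₀) (hm₁ : (univ.filter fun i => s i = 1).card = m₁)
    (Z : Fin d → SpaceTimeIdx L M × SectorLeg (sectorCount (m + 1))) {α : ℝ} (hα : 0 ≤ α)
    (hrow : ∀ X, ∑ Y, ‖((sectorSubMatrix L M β (bgmFatMultiplier L M e₀ β (nambuXiCT L μ K) (m + 1))).transpose *
      normalCovariance L M sym * sectorSubMatrix L M β (bgmFatMultiplier L M e₀ β (nambuXiCT L μ K) (m + 1))) X Y‖ ≤ α)
    (hcol : ∀ Y, ∑ X, ‖((sectorSubMatrix L M β (bgmFatMultiplier L M e₀ β (nambuXiCT L μ K) (m + 1))).transpose *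
      normalCovariance L M sym * sectorSubMatrix L M β (bgmFatMultiplier L M e₀ β (nambuXiCT L μ K) (m + 1))) X Y‖ ≤ α)
    {δ : ℝ} (hδ : 0 ≤ δ)
    (hent : ∀ X Y, ‖((sectorSubMatrix L M β (bgmFatMultiplier L M e₀ β (nambuXiCT L μ K) (m + 1))).transpose *
      normalCovariance L M sym * sectorSubMatrix L M β (bgmFatMultiplier L M e₀ β (nambuXiCT L μ K) (m + 1))) X Y‖ ≤ δ)
    {Na Nb : ℝ} (hNb0 : 0 ≤ Nb)
    (hNa : ∀ X₀ : Fin m₀ → SpaceTimeIdx L M × SectorLeg (sectorCount (m + 1)),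
      ∑ X : Fin (k + 1) → SpaceTimeIdx L M × SectorLeg (sectorCount (m + 1)), ‖kernel ℂ a (k + 1 + m₀) (Fin.append X X₀)‖ ≤ Na)
    (hNb : ∀ (Y₀ : SpaceTimeIdx L M × SectorLeg (sectorCount (m + 1))) (τ : Fin k → SectorLeg (sectorCount (m + 1)))
      (Y₁ : Fin m₁ → SpaceTimeIdx L M × SectorLeg (sectorCount (m + 1))),
      ∑ y : Fin k → SpaceTimeIdx L M, ‖kernel ℂ b (k + 1 + m₁)
        (Fin.append (Fin.cons Y₀ (fun i => (y i, τ i)) : Fin (k + 1) → SpaceTimeIdx L M × SectorLeg (sectorCount (m + 1))) Y₁)‖ ≤ Nb) :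
    ‖kernel ℂ (((grassmannLaplacian ℂ (crossCov ℂ
        ((sectorSubMatrix L M β (bgmFatMultiplier L M e₀ β (nambuXiCT L μ K) (m + 1))).transpose * normalCovariance L M sym *
          sectorSubMatrix L M β (bgmFatMultiplier L M e₀ β (nambuXiCT L μ K) (m + 1))))) ^ (k + 1))
        (dblCopy ℂ 0 a * dblCopy ℂ 1 b)) d (fun i => (Z i, s i))‖ ≤
      (((k + 1 + m₀).factorial * (k + 1 + m₁).factorial : ℝ) / d.factorial) * (α * (36 * δ) ^ k * Na * Nb) := by
  have h := norm_kernel_crossContract_value_pullback_le β (bgmFatMultiplier L M e₀ β (nambuXiCT L μ K) (m + 1))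
    (card_overlap_bgmFat_le_nine (μ := μ) (e₀ := e₀) (β := β) (K := K) m) (fun _ : Fin (k + 1) => sym) a b s hm₀ hm₁ Z hα hrow hcol
    (fun _ => δ) (fun _ => hδ) (fun _ => hent) hNb0 hNa hNb
  rw [prod_const, card_univ, Fintype.card_fin] at h
  have e : (δ * ((4 * 9 : ℕ) : ℝ)) ^ k = (36 * δ) ^ k := by push_cast; ring
  rw [e] at h
  rwa [crossLaplacian_pow_eq_listProd]

end Fat

/-- **The VALUE form of the engine's `k + 1`-line two-vertex term with all line constants discharged.** [cite: BenfattoGiulianiMastropietro2006, §2.8 (2.80)–(2.83)] -/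
theorem norm_kernel_crossLaplacian_pow_klSliceCov_bgmFat_klEng_value (j : ℕ) :
    ∃ C : ℝ, 0 < C ∧ ∃ D : ℝ, 0 < D ∧ ∀ (P : SplitConsts) (R : RenConsts) (c : ℝ), P.WF → R.WF2 → 0 < c → c ≤ EngineV8.klEngC₃3 P R →
      ∀ μ ∈ klWindowC, ∀ U : ℝ, 0 < U → U ≤ EngineV8.klEngU₀4 P R c → ∀ β : ℝ, klBetaMin ≤ β → β ≤ Real.exp (c / U ^ 2) →
      ∀ K : TrigPolyC4v, FrameOK R U (nScales β) μ K → ∀ (L M : ℕ) [NeZero L] [NeZero M],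
      EngineV8.klEngL₃ β U ≤ L → EngineV8.klEngM₃ β U L ≤ M → ∀ n : ℕ, 1 ≤ n → n + j ≤ nScales β + 1 →
      ∀ (k d m₀ m₁ : ℕ) (a b : GrassmannAlgebra ℂ (SpaceTimeIdx L M × SectorLeg (sectorCount n))) (s : Fin d → Fin 2),
        (univ.filter fun i => s i = 0).card = m₀ → (univ.filter fun i => s i = 1).card = m₁ →
        ∀ (Z : Fin d → SpaceTimeIdx L M × SectorLeg (sectorCount n)) (Na Nb : ℝ), 0 ≤ Nb →
        (∀ X₀ : Fin m₀ → SpaceTimeIdx L M × SectorLeg (sectorCount n),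
          ∑ X : Fin (k + 1) → SpaceTimeIdx L M × SectorLeg (sectorCount n), ‖kernel ℂ a (k + 1 + m₀) (Fin.append X X₀)‖ ≤ Na) →
        (∀ (Y₀ : SpaceTimeIdx L M × SectorLeg (sectorCount n)) (τ : Fin k → SectorLeg (sectorCount n))
          (Y₁ : Fin m₁ → SpaceTimeIdx L M × SectorLeg (sectorCount n)),
          ∑ y : Fin k → SpaceTimeIdx L M, ‖kernel ℂ b (k + 1 + m₁)
            (Fin.append (Fin.cons Y₀ (fun i => (y i, τ i)) : Fin (k + 1) → SpaceTimeIdx L M × SectorLeg (sectorCount n)) Y₁)‖ ≤ Nb) →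
        ‖kernel ℂ (((grassmannLaplacian ℂ (crossCov ℂ
            ((sectorSubMatrix L M β (bgmFatMultiplier L M klE0 β (nambuXiCT L μ K) n)).transpose * klSliceCov L M β μ K (n + j) *
              sectorSubMatrix L M β (bgmFatMultiplier L M klE0 β (nambuXiCT L μ K) n)))) ^ (k + 1))
            (dblCopy ℂ 0 a * dblCopy ℂ 1 b)) d (fun i => (Z i, s i))‖ ≤
          (((k + 1 + m₀).factorial * (k + 1 + m₁).factorial : ℝ) / d.factorial) *
            ((C * ((M : ℝ) / β) / klScale klE0 (n + j)) *
              (36 * (D * (klScale klE0 n / klScale klE0 (n + j)) * (klE0 * ((8 : ℝ) ^ n)⁻¹))) ^ k * Na * Nb) := by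
  obtain ⟨C, hC, hα⟩ := alpha_klSliceCov_bgmFat_klEng j
  obtain ⟨D, hD, hδ⟩ := gram_entry_klSliceCov_bgmFat_klEng
  refine ⟨C, hC, D, hD, ?_⟩
  intro P R c hP hR2 hc hc3 μ hμ U hU hU0 β hβmin hβc K hK L M _ _ hL3 hM3 n hn hnN k d m₀ m₁ a b s hm₀ hm₁ Z Na Nb hNb0 hNa hNb
  obtain ⟨hrow, hcol⟩ := hα P R c hP hR2 hc hc3 μ hμ U hU hU0 β hβmin hβc K hK L M hL3 hM3 n hn hnN
  have hent := (hδ P R c hP hR2 hc hc3 μ hμ U hU hU0 β hβmin hβc K hK L M hL3 hM3 n hn (by omega) (n + j) (by omega)).1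
  obtain ⟨m, rfl⟩ : ∃ m, n = m + 1 := ⟨n - 1, by omega⟩
  have he : (0 : ℝ) < klE0 := by norm_num [klE0]
  have hβ0 : 0 < β := pos_of_klBetaMin_le hβmin
  have hM0 : (0 : ℝ) < M := lt_of_lt_of_le hβ0 (EngineV8.le_of_klEngM₃_le hβmin hL3 hM3)
  have hα0 : 0 ≤ C * ((M : ℝ) / β) / klScale klE0 (m + 1 + j) := by have := klth_klScale_pos (m + 1 + j); positivity
  have hδ0 : 0 ≤ D * (klScale klE0 (m + 1) / klScale klE0 (m + 1 + j)) * (klE0 * ((8 : ℝ) ^ (m + 1))⁻¹) := by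
    have := klth_klScale_pos (m + 1); have := klth_klScale_pos (m + 1 + j); positivity
  obtain ⟨sym, hS⟩ : ∃ sym : FreqMomentum L M × Fin 2 → ℂ, klSliceCov L M β μ K (m + 1 + j) = normalCovariance L M sym :=
    ⟨_, by rw [klSliceCov, hubbardCovSliceCT_zero_seed]⟩
  rw [hS] at hrow hcol hent ⊢
  exact norm_kernel_crossLaplacian_pow_bgmFat_value_le klE0 β μ K m sym a b s hm₀ hm₁ Z hα0 hrow hcol hδ0 hent hNb0 hNa hNb

end Summit.HubbardSuperconductivity.HubbardSuperconductivity.Theorems.KLRegimeWick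

end
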